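import Literature.Geometry.Symplectic.PencilEndMemberGlued
import Mathlib.Analysis.InnerProductSpace.Calculus
import HarnessLib

/-!
# Flat-coordinate frame calculus at a standard end, and the far normal frame of a pencil member

Topic `Literature/Geometry/Symplectic` (infrastructure for
`Literature.Geometry.Symplectic.jPlanePencil_localFamily_homotopySphere`, Wendl LNM 2216, proof of
Prop. 2.53, p. 65: the compactified member in the blown-up end has trivial normal bundle).

For a point `p` of a `4`-manifold `M` with flat end coordinates `(z, w) = flatChart p` on the
punctured chart ball (`flatChart p m = flatCx (ι (e m − e p))`, `ι(y) = y/‖y‖²`) we record the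
explicit derivative of the inversion (`inversionDeriv`, a scaled reflection) and of the flat chart
(`flatDeriv p m = flatCx ∘ Dι(e m − e p) ∘ τ_{m → p}`, equal to `pencilCoordDeriv` of
`PencilEndAlmostComplex.lean`), and define the **far normal frame** of a plane `u : ℂ → M ∖ p`:

  `farFrame p u ξ : ℝ² →L T_{u ξ} M`,  `c ↦ D(endPt p)_{(1/z, w)(u ξ)} (0, c)`,

the push-forward of the constant frame `∂_w, i∂_w` of the blown-up coordinates `(x', w) = (1/z, w)`.
Its flat coordinates are exactly `(0, c)` (`flatDeriv_comp_farFrame`), so read in the exceptional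
chart of the glued manifold `Y` it is the constant frame `flatCx⁻¹ (0, c)`
(`exceptionalReading_farFrame`), and read in any chart of `M` it is a `C^∞` function of `ξ`
(`contMDiffOn_chartReading_farFrame`). These are the far half of the framing of the compactified
member used to produce its trivial-normal-bundle witness in `Y`.

## References

* C. Wendl, *Holomorphic Curves in Low Dimensions*, LNM 2216 (2018), proof of Prop. 2.53, p. 65.
  [Wendl2018]
* M. Gromov, *Pseudo holomorphic curves in symplectic manifolds*, Invent. Math. 82 (1985), 2.4.A′
  (the flat end). [Gromov1985]
-/

noncomputable section

open scoped Manifold ContDiff Topology RealInnerProductSpace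
open Set Function Metric Filter Literature.Topology.FourManifolds

namespace Literature.Geometry.Symplectic

/-! ### `ℝ² = ℂ` -/

/-- The identification `ℝ² ≅ ℂ`, `c ↦ c₀ + i c₁`. [folklore] -/
def e2c : EuclideanSpace ℝ (Fin 2) ≃L[ℝ] ℂ :=
  LinearEquiv.toContinuousLinearEquiv
    { toFun := fun v => ⟨v 0, v 1⟩
      invFun := fun c => !₂[c.re, c.im]
      map_add' := fun a b => by apply Complex.ext <;> simp
      map_smul' := fun r a => by apply Complex.ext <;> simp
      left_inv := fun v => by ext i; fin_cases i <;> rfl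
      right_inv := fun c => by apply Complex.ext <;> rfl }

/-- Values of `e2c`. [folklore] -/
@[simp] theorem e2c_apply (v : EuclideanSpace ℝ (Fin 2)) : e2c v = ⟨v 0, v 1⟩ := rfl

/-- The inclusion of the `w`-axis: `c ↦ (0, c)`. [folklore] -/
def inrC : ℂ →L[ℝ] ℂ × ℂ := ContinuousLinearMap.inr ℝ ℂ ℂ

/-- Values of `inrC`. [folklore] -/
@[simp] theorem inrC_apply (c : ℂ) : inrC c = (0, c) := rfl

/-- `blowDownDeriv` fixes the `w`-axis. [folklore] -/
@[simp] theorem blowDownDeriv_inrC (X c : ℂ) : blowDownDeriv X (inrC c) = inrC c := by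
  simp [inrC]

/-! ### The explicit derivative of the inversion of `ℝ⁴` -/

section Inversion

/-- Local notation for the model space `ℝ⁴`. -/
local notation "E4" => EuclideanSpace ℝ (Fin 4)

/-- **The derivative of the inversion** `ι(y) = y/‖y‖²` at `y ≠ 0`:
`v ↦ ‖y‖⁻² v − 2⟪y, v⟫ ‖y‖⁻⁴ y`. [cite: Gromov1985, §0.3.C] -/
def inversionDeriv (y : E4) : E4 →L[ℝ] E4 :=
  (‖y‖ ^ 2)⁻¹ • ContinuousLinearMap.id ℝ E4 +
    ((-((‖y‖ ^ 2) ^ 2)⁻¹ * 2) • (innerSL ℝ y : E4 →L[ℝ] ℝ)).smulRight y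

/-- Raw values of `inversionDeriv`. [folklore] -/
theorem inversionDeriv_apply' (y v : E4) :
    inversionDeriv y v = (‖y‖ ^ 2)⁻¹ • v + ((-((‖y‖ ^ 2) ^ 2)⁻¹ * 2) * ⟪y, v⟫) • y := by
  rfl

/-- Values of `inversionDeriv`. [folklore] -/
theorem inversionDeriv_apply (y v : E4) :
    inversionDeriv y v = (‖y‖ ^ 2)⁻¹ • v - (2 * ⟪y, v⟫ / (‖y‖ ^ 2) ^ 2) • y := by
  rw [inversionDeriv_apply', sub_eq_add_neg, ← neg_smul]
  congr 2
  ring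

/-- `inversion` has derivative `inversionDeriv y` at `y ≠ 0`. [folklore] -/
theorem hasFDerivAt_inversion {y : E4} (hy : y ≠ 0) : HasFDerivAt inversion (inversionDeriv y) y := by
  have hne : ‖y‖ ^ 2 ≠ 0 := pow_ne_zero 2 (norm_ne_zero_iff.2 hy)
  have h1 : HasFDerivAt (fun z : E4 => (‖z‖ ^ 2)⁻¹)
      ((-((‖y‖ ^ 2) ^ 2)⁻¹ * 2) • (innerSL ℝ y : E4 →L[ℝ] ℝ)) y := by
    have h := (hasFDerivAt_inv hne).comp y (hasStrictFDerivAt_norm_sq y).hasFDerivAt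
    refine h.congr_fderiv ?_
    ext v
    simp only [ContinuousLinearMap.comp_apply, ContinuousLinearMap.toSpanSingleton_apply,
      smul_apply, innerSL_apply_apply, smul_eq_mul]
    ring
  exact h1.smul (hasFDerivAt_id (𝕜 := ℝ) y)

/-- `fderiv ℝ inversion y = inversionDeriv y` for `y ≠ 0`. [folklore] -/
theorem fderiv_inversion_eq {y : E4} (hy : y ≠ 0) : fderiv ℝ inversion y = inversionDeriv y :=
  (hasFDerivAt_inversion hy).fderiv

/-- **Scaled reflection form**: `‖y‖² Dι(y) v = v − 2⟪ŷ, v⟫ ŷ`, i.e.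
`‖y‖² • inversionDeriv y v = v − (2⟪y, v⟫/‖y‖²) • y`. [folklore] -/
theorem norm_sq_smul_inversionDeriv_apply {y : E4} (hy : y ≠ 0) (v : E4) :
    (‖y‖ ^ 2) • inversionDeriv y v = v - (2 * ⟪y, v⟫ / ‖y‖ ^ 2) • y := by
  have hne : ‖y‖ ^ 2 ≠ 0 := pow_ne_zero 2 (norm_ne_zero_iff.2 hy)
  rw [inversionDeriv_apply, smul_sub, smul_smul, mul_inv_cancel₀ hne, one_smul, smul_smul]
  congr 2
  field_simp

/-- The correction term of the scaled reflection is bounded by `2‖v‖` (Cauchy–Schwarz):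
`‖(2⟪y, v⟫/‖y‖²) • y‖ ≤ 2‖v‖`. [folklore] -/
theorem norm_reflectionCorrection_le {y : E4} (hy : y ≠ 0) (v : E4) :
    ‖(2 * ⟪y, v⟫ / ‖y‖ ^ 2) • y‖ ≤ 2 * ‖v‖ := by
  have hpos : 0 < ‖y‖ := norm_pos_iff.2 hy
  rw [norm_smul, Real.norm_eq_abs, abs_div, abs_mul, abs_of_pos (by positivity : (0 : ℝ) < ‖y‖ ^ 2),
    abs_two]
  have hcs : |⟪y, v⟫| ≤ ‖y‖ * ‖v‖ := abs_real_inner_le_norm y v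
  calc 2 * |⟪y, v⟫| / ‖y‖ ^ 2 * ‖y‖ = 2 * |⟪y, v⟫| / ‖y‖ := by
        field_simp
    _ ≤ 2 * (‖y‖ * ‖v‖) / ‖y‖ := by gcongr
    _ = 2 * ‖v‖ := by field_simp

/-- The scaled reflection is bounded by `3‖v‖`. [folklore] -/
theorem norm_norm_sq_smul_inversionDeriv_le {y : E4} (hy : y ≠ 0) (v : E4) :
    ‖(‖y‖ ^ 2) • inversionDeriv y v‖ ≤ 3 * ‖v‖ := by
  rw [norm_sq_smul_inversionDeriv_apply hy]
  calc ‖v - (2 * ⟪y, v⟫ / ‖y‖ ^ 2) • y‖ ≤ ‖v‖ + ‖(2 * ⟪y, v⟫ / ‖y‖ ^ 2) • y‖ := norm_sub_le _ _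
    _ ≤ ‖v‖ + 2 * ‖v‖ := by gcongr; exact norm_reflectionCorrection_le hy v
    _ = 3 * ‖v‖ := by ring

end Inversion

/-! ### The flat chart at `M`-level and its derivative -/

section FlatChart

variable {M : Type*} [TopologicalSpace M] [T2Space M] [ChartedSpace (EuclideanSpace ℝ (Fin 4)) M]

/-- The recentred chart vector `e m − e p`. [folklore] -/
def recentre (p m : M) : EuclideanSpace ℝ (Fin 4) := extChartAt (𝓡 4) p m - extChartAt (𝓡 4) p p

/-- **The flat end coordinates on `M`**: `flatChart p m = flatCx (ι (e m − e p))` (`= pencilCoord`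
on `M ∖ p`). [cite: Gromov1985, 2.4.A'] -/
def flatChart (p m : M) : ℂ × ℂ := flatCx (inversion (recentre p m))

/-- On `M ∖ p` the flat chart is `pencilCoord`. [folklore] -/
theorem flatChart_val (p : M) (x : punctured p) : flatChart p x.1 = pencilCoord p x :=
  (pencilCoord_eq_flatCx p x).symm

/-- The flat chart as a function: `pencilCoord p = flatChart p ∘ val`. [folklore] -/
theorem pencilCoord_eq_flatChart_comp (p : M) :
    (pencilCoord p : punctured p → ℂ × ℂ) = flatChart p ∘ (Subtype.val : punctured p → M) :=
  funext fun x => (flatChart_val p x).symm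

variable [IsManifold (𝓡 4) ∞ M]

/-- **The derivative of the flat chart** at `m`: `flatCx ∘ Dι(e m − e p) ∘ τ_{m → p}(m)` (the last
factor is the derivative of the chart change from the preferred chart at `m` to that at `p`).
[folklore] -/
def flatDeriv (p m : M) : EuclideanSpace ℝ (Fin 4) →L[ℝ] ℂ × ℂ :=
  (flatCx : EuclideanSpace ℝ (Fin 4) →L[ℝ] ℂ × ℂ).comp
    ((inversionDeriv (recentre p m)).comp (tangentCoordChange (𝓡 4) m p m))

omit [T2Space M] in
/-- **The derivative of the extended chart is the change of tangent coordinates**: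
`D(e_p)(m) = τ_{m → p}(m)` for `m` in the chart domain of `p`. [folklore] -/
theorem hasMFDerivAt_extChartAt_tangentCoordChange {p m : M}
    (hm : m ∈ (chartAt (EuclideanSpace ℝ (Fin 4)) p).source) :
    HasMFDerivAt (𝓡 4) 𝓘(ℝ, EuclideanSpace ℝ (Fin 4)) (extChartAt (𝓡 4) p) m
      (tangentCoordChange (𝓡 4) m p m) := by
  have h := hasMFDerivAt_extChartAt (I := 𝓡 4) hm
  rwa [mfderiv_chartAt_eq_tangentCoordChange (I := 𝓡 4) hm] at h

omit [T2Space M] in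
/-- **The flat chart has derivative `flatDeriv`** at points of the chart domain other than `p`.
[folklore] -/
theorem hasMFDerivAt_flatChart {p m : M} (hm : m ∈ (chartAt (EuclideanSpace ℝ (Fin 4)) p).source)
    (hne : recentre p m ≠ 0) :
    HasMFDerivAt (𝓡 4) 𝓘(ℝ, ℂ × ℂ) (flatChart p) m (flatDeriv p m) := by
  have h1 : HasFDerivAt (fun y : EuclideanSpace ℝ (Fin 4) =>
      flatCx (inversion (y - extChartAt (𝓡 4) p p)))
      ((flatCx : EuclideanSpace ℝ (Fin 4) →L[ℝ] ℂ × ℂ).comp (inversionDeriv (recentre p m)))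
      (extChartAt (𝓡 4) p m) := by
    have hi : HasFDerivAt inversion (inversionDeriv (recentre p m))
        (extChartAt (𝓡 4) p m - extChartAt (𝓡 4) p p) := hasFDerivAt_inversion hne
    have h2 := hi.comp (extChartAt (𝓡 4) p m) (hasFDerivAt_sub_const (extChartAt (𝓡 4) p p))
    rw [ContinuousLinearMap.comp_id] at h2
    exact flatCx.hasFDerivAt.comp _ h2
  have h := h1.hasMFDerivAt.comp m (hasMFDerivAt_extChartAt_tangentCoordChange hm)
  have hfun : (fun y : EuclideanSpace ℝ (Fin 4) => flatCx (inversion (y - extChartAt (𝓡 4) p p))) ∘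
      extChartAt (𝓡 4) p = flatChart p := rfl
  rw [hfun] at h
  exact h.congr_mfderiv (ContinuousLinearMap.comp_assoc _ _ _)

/-- **`pencilCoordDeriv = flatDeriv`** on the punctured chart ball. [folklore] -/
theorem pencilCoordDeriv_eq_flatDeriv {p : M} {ε : ℝ} {x : punctured p}
    (hx : InPuncturedChartBall p ε x) : pencilCoordDeriv x = flatDeriv p x.1 := by
  have h0 := (hasMFDerivAt_flatChart hx.1 (extChartAt_sub_ne_zero x hx.1)).comp x
    (Literature.Geometry.Manifold.OpenSubmanifold.hasMFDerivAt_subtype_val (I := 𝓡 4) x)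
  have h1 : HasMFDerivAt (𝓡 4) 𝓘(ℝ, ℂ × ℂ) (pencilCoord p) x (flatDeriv p x.1) := by
    rw [pencilCoord_eq_flatChart_comp]
    exact h0.congr_mfderiv (ContinuousLinearMap.comp_id _)
  rw [pencilCoordDeriv_def]
  exact h1.mfderiv

end FlatChart

/-! ### The far normal frame of a plane -/

section FarFrame

variable {M : Type*} [TopologicalSpace M] [T2Space M] [ChartedSpace (EuclideanSpace ℝ (Fin 4)) M]

/-- The blown-up coordinates `(x', w) = (1/z, w)` of the point `u ξ`. [folklore] -/
def farPt (p : M) (u : ℂ → punctured p) (ξ : ℂ) : ℂ × ℂ := blowDown (pencilCoord p (u ξ))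

/-- **The far normal frame** of a plane `u : ℂ → M ∖ p`: the push-forward by the blown-up end
coordinates of the constant frame of the `w`-axis, `c ↦ D(endPt p)_{(1/z, w)(u ξ)} (0, c)`, a
linear map `ℝ² →L T_{u ξ} M` (read in the preferred chart at `u ξ`).
[cite: Wendl2018, proof of Prop. 2.53 (p. 65)] -/
def farFrame (p : M) (u : ℂ → punctured p) (ξ : ℂ) :
    EuclideanSpace ℝ (Fin 2) →L[ℝ] EuclideanSpace ℝ (Fin 4) :=
  (mfderiv 𝓘(ℝ, ℂ × ℂ) (𝓡 4) (endPt p) (farPt p u ξ)).comp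
    (inrC.comp (e2c : EuclideanSpace ℝ (Fin 2) →L[ℝ] ℂ))

variable {p : M} (G : PencilEnd p) {u : ℂ → punctured p}

namespace PencilEnd

/-- On the gluing region `farPt` is the gluing map. [folklore] -/
theorem farPt_eq_glueFun {ξ : ℂ} (hx : u ξ ∈ G.src) : farPt p u ξ = (G.glueFun (u ξ) : ℂ × ℂ) := by
  rw [G.glueFun_of_mem hx]; rfl

/-- On the gluing region `(farPt).1 = 1/z ≠ 0`. [folklore] -/
theorem farPt_fst_ne_zero {ξ : ℂ} (hx : u ξ ∈ G.src) : (farPt p u ξ).1 ≠ 0 :=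
  inv_ne_zero (G.fst_ne_zero_of_mem_src hx)

/-- On the gluing region `‖(farPt).1‖ < ρ`. [folklore] -/
theorem norm_farPt_fst_lt {ξ : ℂ} (hx : u ξ ∈ G.src) : ‖(farPt p u ξ).1‖ < G.ρ := by
  rw [G.farPt_eq_glueFun hx]; exact G.norm_fst_lt _

/-- **`endPt` inverts the blown-up coordinates**: `endPt p ((1/z, w)(u ξ)) = u ξ` on the gluing
region. [folklore] -/
theorem endPt_farPt {ξ : ℂ} (hx : u ξ ∈ G.src) : endPt p (farPt p u ξ) = (u ξ).1 := by
  rw [G.farPt_eq_glueFun hx, ← G.coe_glueInv_of_mem (G.glueFun_mem_tgt hx), G.glueInv_glueFun hx]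

omit [T2Space M] in
/-- The recentred chart vector of `endPt q` is `endChartVec q`. [folklore] -/
theorem recentre_endPt {q : ℂ × ℂ} (hq : q.1 ≠ 0) (hqρ : ‖q.1‖ < G.ρ) :
    recentre p (endPt p q) = endChartVec q := by
  rw [recentre, G.extChartAt_endPt hq hqρ, add_sub_cancel_left]

omit [T2Space M] in
/-- **The flat chart of `endPt q` is `(1/x', w)`**: `flatChart p (endPt p q) = blowDown q`.
[folklore] -/
theorem flatChart_endPt {q : ℂ × ℂ} (hq : q.1 ≠ 0) (hqρ : ‖q.1‖ < G.ρ) :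
    flatChart p (endPt p q) = blowDown q := by
  rw [flatChart, G.recentre_endPt hq hqρ, flatCx_inversion_endChartVec]; rfl

/-- The open set of blown-up coordinates `q` with `0 < ‖x'‖ < ρ` and `endPt q` in the chart domain
of `a`. [folklore] -/
def farChartDom (a : M) : Set (ℂ × ℂ) :=
  {q | q.1 ≠ 0 ∧ ‖q.1‖ < G.ρ ∧ endPt p q ∈ (chartAt (EuclideanSpace ℝ (Fin 4)) a).source}

omit [T2Space M] in
/-- `farChartDom a` is open. [folklore] -/
theorem isOpen_farChartDom (a : M) : IsOpen (G.farChartDom a) := by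
  have h1 : IsOpen {q : ℂ × ℂ | q.1 ≠ 0 ∧ ‖q.1‖ < G.ρ} :=
    (isOpen_ne_fun continuous_fst continuous_const).inter (isOpen_lt continuous_fst.norm continuous_const)
  have hc : ContinuousOn (endPt p) {q : ℂ × ℂ | q.1 ≠ 0 ∧ ‖q.1‖ < G.ρ} :=
    fun q hq => (G.continuousAt_endPt hq.1 hq.2).continuousWithinAt
  have h2 := hc.isOpen_inter_preimage h1 (chartAt (EuclideanSpace ℝ (Fin 4)) a).open_source
  convert h2 using 1
  ext q
  simp only [farChartDom, mem_setOf_eq, mem_inter_iff, mem_preimage]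
  tauto

variable [IsManifold (𝓡 4) ∞ M]

omit [T2Space M] in
/-- `endPt` is differentiable at `q` with `0 < ‖x'‖ < ρ`, with derivative `mfderiv`. [folklore] -/
theorem hasMFDerivAt_endPt {q : ℂ × ℂ} (hq : q.1 ≠ 0) (hqρ : ‖q.1‖ < G.ρ) :
    HasMFDerivAt 𝓘(ℝ, ℂ × ℂ) (𝓡 4) (endPt p) q (mfderiv 𝓘(ℝ, ℂ × ℂ) (𝓡 4) (endPt p) q) :=
  ((G.contMDiffAt_endPt hq hqρ).mdifferentiableAt (by simp)).hasMFDerivAt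

omit [T2Space M] in
/-- **The flat chain rule for `endPt`**: `flatDeriv (endPt q) (D(endPt)(q) v) = blowDownDeriv x' v`
for `0 < ‖x'‖ < ρ`. [folklore] -/
theorem flatDeriv_mfderiv_endPt_apply {q : ℂ × ℂ} (hq : q.1 ≠ 0) (hqρ : ‖q.1‖ < G.ρ) (v : ℂ × ℂ) :
    flatDeriv p (endPt p q) (mfderiv 𝓘(ℝ, ℂ × ℂ) (𝓡 4) (endPt p) q v) = blowDownDeriv q.1 v := by
  -- `flatChart ∘ endPt` has derivative `flatDeriv ∘ D(endPt)` ...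
  have hne : recentre p (endPt p q) ≠ 0 := by
    rw [G.recentre_endPt hq hqρ]; exact endChartVec_ne_zero hq
  have h1 : HasMFDerivAt 𝓘(ℝ, ℂ × ℂ) 𝓘(ℝ, ℂ × ℂ) (flatChart p ∘ endPt p) q
      ((flatDeriv p (endPt p q)).comp (mfderiv 𝓘(ℝ, ℂ × ℂ) (𝓡 4) (endPt p) q)) :=
    (hasMFDerivAt_flatChart (G.endPt_mem_source hq hqρ) hne).comp q (G.hasMFDerivAt_endPt hq hqρ)
  -- ... and equals `blowDown` near `q`
  have hev : flatChart p ∘ endPt p =ᶠ[𝓝 q] blowDown := by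
    have ho : IsOpen {q' : ℂ × ℂ | q'.1 ≠ 0 ∧ ‖q'.1‖ < G.ρ} :=
      (isOpen_ne_fun continuous_fst continuous_const).inter
        (isOpen_lt continuous_fst.norm continuous_const)
    filter_upwards [ho.mem_nhds ⟨hq, hqρ⟩] with q' hq'
    exact G.flatChart_endPt hq'.1 hq'.2
  have h2 : HasMFDerivAt 𝓘(ℝ, ℂ × ℂ) 𝓘(ℝ, ℂ × ℂ) (flatChart p ∘ endPt p) q (blowDownDeriv q.1) :=
    (hasFDerivAt_blowDown hq).hasMFDerivAt.congr_of_eventuallyEq hev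
  have h3 := h1.mfderiv.symm.trans h2.mfderiv
  exact DFunLike.congr_fun h3 v

/-- **The far frame has flat coordinates `(0, c)`**: `flatDeriv (u ξ) (farFrame p u ξ c) = (0, e2c c)`
on the gluing region. [cite: Wendl2018, proof of Prop. 2.53 (p. 65)] -/
theorem flatDeriv_farFrame_apply {ξ : ℂ} (hx : u ξ ∈ G.src) (c : EuclideanSpace ℝ (Fin 2)) :
    flatDeriv p (u ξ).1 (farFrame p u ξ c) = (0, e2c c) := by
  have h := G.flatDeriv_mfderiv_endPt_apply (G.farPt_fst_ne_zero hx) (G.norm_farPt_fst_lt hx)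
    (inrC (e2c c))
  rw [G.endPt_farPt hx, blowDownDeriv_inrC] at h
  exact h

/-- The same at the level of linear maps. [folklore] -/
theorem flatDeriv_comp_farFrame {ξ : ℂ} (hx : u ξ ∈ G.src) :
    (flatDeriv p (u ξ).1).comp (farFrame p u ξ) =
      inrC.comp (e2c : EuclideanSpace ℝ (Fin 2) →L[ℝ] ℂ) :=
  ContinuousLinearMap.ext fun c => G.flatDeriv_farFrame_apply hx c

/-- The same with `pencilCoordDeriv`. [folklore] -/
theorem pencilCoordDeriv_farFrame_apply {ξ : ℂ} (hx : u ξ ∈ G.src) (c : EuclideanSpace ℝ (Fin 2)) :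
    pencilCoordDeriv (u ξ) (farFrame p u ξ c) = (0, e2c c) := by
  rw [pencilCoordDeriv_eq_flatDeriv hx.1]; exact G.flatDeriv_farFrame_apply hx c

/-- **The far frame is injective** on the gluing region. [folklore] -/
theorem injective_farFrame {ξ : ℂ} (hx : u ξ ∈ G.src) : Injective (farFrame p u ξ) := by
  intro c₁ c₂ h
  have h' := congrArg (flatDeriv p (u ξ).1) h
  rw [G.flatDeriv_farFrame_apply hx, G.flatDeriv_farFrame_apply hx, Prod.mk.injEq] at h'
  exact e2c.injective h'.2

/-- **The far frame read in the exceptional chart of `Y` is the constant frame `flatCx⁻¹ (0, c)`.**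
(The change of tangent coordinates from `inP (u ξ)` to an exceptional chart is
`flatCx⁻¹ ∘ blowDownDeriv (z) ∘ pencilCoordDeriv`, `tangentCoordChange_inP_inB`.)
[cite: Wendl2018, proof of Prop. 2.53 (p. 65)] -/
theorem exceptionalReading_farFrame {q : G.box} (hq : (q : ℂ × ℂ).1 = 0) {ξ : ℂ} (hx : u ξ ∈ G.src)
    (c : EuclideanSpace ℝ (Fin 2)) :
    tangentCoordChange (𝓡 4) (G.inP (u ξ)) (G.inB q) (G.inP (u ξ)) (farFrame p u ξ c) =
      flatCx.symm (0, e2c c) := by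
  rw [G.tangentCoordChange_inP_inB hq hx]
  change flatCx.symm (blowDownDeriv (pencilCoord p (u ξ)).1 (pencilCoordDeriv (u ξ) (farFrame p u ξ c)))
    = _
  rw [G.pencilCoordDeriv_farFrame_apply hx c, ← inrC_apply, blowDownDeriv_inrC]

/-! ### Smoothness of the far frame read in a chart of `M` -/

omit [T2Space M] in
/-- `e_a ∘ endPt` is `C^∞` on `farChartDom a`. [folklore] -/
theorem contDiffOn_extChartAt_comp_endPt (a : M) :
    ContDiffOn ℝ ∞ (fun q : ℂ × ℂ => extChartAt (𝓡 4) a (endPt p q)) (G.farChartDom a) := by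
  intro q hq
  have h1 : ContMDiffAt 𝓘(ℝ, ℂ × ℂ) 𝓘(ℝ, EuclideanSpace ℝ (Fin 4)) ∞
      (fun q : ℂ × ℂ => extChartAt (𝓡 4) a (endPt p q)) q :=
    (contMDiffAt_extChartAt' (I := 𝓡 4) (n := ∞) hq.2.2).comp q (G.contMDiffAt_endPt hq.1 hq.2.1)
  exact (contMDiffAt_iff_contDiffAt.1 h1).contDiffWithinAt

/-- **The far frame read in the chart at `a` is the Fréchet derivative of `e_a ∘ endPt`**:
`τ_{u ξ → a}(u ξ) (farFrame p u ξ c) = fderiv (e_a ∘ endPt p) ((1/z, w)(u ξ)) (0, e2c c)`.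
[folklore] -/
theorem chartReading_farFrame_apply {a : M} {ξ : ℂ} (hx : u ξ ∈ G.src)
    (ha : (u ξ).1 ∈ (chartAt (EuclideanSpace ℝ (Fin 4)) a).source) (c : EuclideanSpace ℝ (Fin 2)) :
    tangentCoordChange (𝓡 4) (u ξ).1 a (u ξ).1 (farFrame p u ξ c) =
      fderiv ℝ (fun q : ℂ × ℂ => extChartAt (𝓡 4) a (endPt p q)) (farPt p u ξ) (inrC (e2c c)) := by
  have hq : (farPt p u ξ).1 ≠ 0 := G.farPt_fst_ne_zero hx
  have hqρ : ‖(farPt p u ξ).1‖ < G.ρ := G.norm_farPt_fst_lt hx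
  have ha' : endPt p (farPt p u ξ) ∈ (chartAt (EuclideanSpace ℝ (Fin 4)) a).source := by
    rw [G.endPt_farPt hx]; exact ha
  have h1 : HasMFDerivAt 𝓘(ℝ, ℂ × ℂ) 𝓘(ℝ, EuclideanSpace ℝ (Fin 4))
      (fun q : ℂ × ℂ => extChartAt (𝓡 4) a (endPt p q)) (farPt p u ξ)
      ((tangentCoordChange (𝓡 4) (endPt p (farPt p u ξ)) a (endPt p (farPt p u ξ))).comp
        (mfderiv 𝓘(ℝ, ℂ × ℂ) (𝓡 4) (endPt p) (farPt p u ξ))) :=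
    (hasMFDerivAt_extChartAt_tangentCoordChange ha').comp (farPt p u ξ) (G.hasMFDerivAt_endPt hq hqρ)
  have h2 := h1.mfderiv
  rw [mfderiv_eq_fderiv] at h2
  rw [h2]
  change _ = tangentCoordChange (𝓡 4) (endPt p (farPt p u ξ)) a (endPt p (farPt p u ξ))
    (mfderiv 𝓘(ℝ, ℂ × ℂ) (𝓡 4) (endPt p) (farPt p u ξ) (inrC (e2c c)))
  rw [G.endPt_farPt hx]
  rfl

/-- The same at the level of linear maps. [folklore] -/
theorem chartReading_farFrame_eq {a : M} {ξ : ℂ} (hx : u ξ ∈ G.src)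
    (ha : (u ξ).1 ∈ (chartAt (EuclideanSpace ℝ (Fin 4)) a).source) :
    (tangentCoordChange (𝓡 4) (u ξ).1 a (u ξ).1).comp (farFrame p u ξ) =
      (fderiv ℝ (fun q : ℂ × ℂ => extChartAt (𝓡 4) a (endPt p q)) (farPt p u ξ)).comp
        (inrC.comp (e2c : EuclideanSpace ℝ (Fin 2) →L[ℝ] ℂ)) :=
  ContinuousLinearMap.ext fun c => G.chartReading_farFrame_apply hx ha c

/-- The blown-up coordinates of `u ξ` depend smoothly on `ξ` on the gluing region, for a smooth
plane `u`. [folklore] -/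
theorem contMDiffOn_farPt (hu : ContMDiff 𝓘(ℝ, ℂ) (𝓡 4) ∞ u) :
    ContMDiffOn 𝓘(ℝ, ℂ) 𝓘(ℝ, ℂ × ℂ) ∞ (farPt p u) {ξ | u ξ ∈ G.src} := by
  intro ξ hξ
  have h1 : ContMDiffAt 𝓘(ℝ, ℂ) 𝓘(ℝ, ℂ × ℂ) ∞ (fun ξ => pencilCoord p (u ξ)) ξ :=
    ((contMDiffOn_pencilCoord p G.rad).contMDiffAt
      ((isOpen_setOf_inPuncturedChartBall p G.rad).mem_nhds hξ.1)).comp ξ (hu ξ)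
  have h2 : ContMDiffAt 𝓘(ℝ, ℂ × ℂ) 𝓘(ℝ, ℂ × ℂ) ∞ blowDown (pencilCoord p (u ξ)) :=
    ((contDiffAt_fst.inv (G.fst_ne_zero_of_mem_src hξ)).prodMk contDiffAt_snd).contMDiffAt
  exact (h2.comp ξ h1).contMDiffWithinAt

/-- **The far frame read in the chart at `a` is a `C^∞` function of `ξ`** on the open set where
`u ξ` lies in the gluing region and in the chart domain of `a`.
[cite: Wendl2018, proof of Prop. 2.53 (p. 65)] -/
theorem contMDiffOn_chartReading_farFrame (hu : ContMDiff 𝓘(ℝ, ℂ) (𝓡 4) ∞ u) (a : M) :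
    ContMDiffOn 𝓘(ℝ, ℂ) 𝓘(ℝ, EuclideanSpace ℝ (Fin 2) →L[ℝ] EuclideanSpace ℝ (Fin 4)) ∞
      (fun ξ => (tangentCoordChange (𝓡 4) (u ξ).1 a (u ξ).1).comp (farFrame p u ξ))
      {ξ | u ξ ∈ G.src ∧ (u ξ).1 ∈ (chartAt (EuclideanSpace ℝ (Fin 4)) a).source} := by
  -- the derivative of `e_a ∘ endPt` is smooth on `farChartDom a`
  have hD : ContDiffOn ℝ ∞ (fderiv ℝ (fun q : ℂ × ℂ => extChartAt (𝓡 4) a (endPt p q)))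
      (G.farChartDom a) :=
    (G.contDiffOn_extChartAt_comp_endPt a).fderiv_of_isOpen (G.isOpen_farChartDom a) (by simp)
  -- `farPt` maps our set into `farChartDom a`
  have hmaps : MapsTo (farPt p u) {ξ | u ξ ∈ G.src ∧ (u ξ).1 ∈ (chartAt (EuclideanSpace ℝ (Fin 4)) a).source}
      (G.farChartDom a) := by
    intro ξ hξ
    refine ⟨G.farPt_fst_ne_zero hξ.1, G.norm_farPt_fst_lt hξ.1, ?_⟩
    rw [G.endPt_farPt hξ.1]; exact hξ.2
  have hF : ContMDiffOn 𝓘(ℝ, ℂ) 𝓘(ℝ, ℂ × ℂ →L[ℝ] EuclideanSpace ℝ (Fin 4)) ∞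
      (fun ξ => fderiv ℝ (fun q : ℂ × ℂ => extChartAt (𝓡 4) a (endPt p q)) (farPt p u ξ))
      {ξ | u ξ ∈ G.src ∧ (u ξ).1 ∈ (chartAt (EuclideanSpace ℝ (Fin 4)) a).source} :=
    hD.contMDiffOn.comp ((G.contMDiffOn_farPt hu).mono fun ξ hξ => hξ.1) hmaps
  have hcomp : ContMDiffOn 𝓘(ℝ, ℂ) 𝓘(ℝ, EuclideanSpace ℝ (Fin 2) →L[ℝ] EuclideanSpace ℝ (Fin 4)) ∞
      (fun ξ => (fderiv ℝ (fun q : ℂ × ℂ => extChartAt (𝓡 4) a (endPt p q)) (farPt p u ξ)).comp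
        (inrC.comp (e2c : EuclideanSpace ℝ (Fin 2) →L[ℝ] ℂ)))
      {ξ | u ξ ∈ G.src ∧ (u ξ).1 ∈ (chartAt (EuclideanSpace ℝ (Fin 4)) a).source} :=
    hF.clm_comp contMDiffOn_const
  refine hcomp.congr fun ξ hξ => ?_
  exact G.chartReading_farFrame_eq hξ.1 hξ.2

end PencilEnd

end FarFrame

end Literature.Geometry.Symplectic
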